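import Literature.NumberTheory.Automorphic.ResGLnKugaHarmonic
import HarnessLib

/-!
# Basic cocycles of `C^•(𝔤, K_∞; W ⊗ E_λ)` are relative for `K' = 𝔨 ⊕ ℝ·1`

Topic `NumberTheory/Automorphic`; namespace `Literature.NumberTheory.Automorphic.ConeDictionary`
(vocabulary of `ResGLnConeDictionary`, `ResGLnKugaHarmonic`).  Theorems only; no definition, no
named fact, no `sorry`.

Step 0 of Borel's injectivity of cuspidal cohomology in the cone model
(`ResGLnCuspidalCohomologyApex`, fact `Borel1983_coneClass_ne_zero`) in the vocabulary of the
Step-2 assembly `ResGLnKugaHarmonic.d_eq_zero_and_coclosed_of_casimir_scalar`: a cochain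
`η ∈ C^{q+1}(𝔤, K_∞; W ⊗ E_λ)` of the complex `gkComplexLS π S λ` which is BASIC (`i_Z η = 0`,
`Z = 1 ∈ 𝔤` the generator of the split centre) and CLOSED is a cochain of the relative complex for
`K' = 𝔨 ⊕ ℝ·1` (`kPrimeD`): `mem_rel_kPrimeD_of_basic_cocycle` (with `Z = ⟨1, trivial⟩` literally as
in the fact's hypothesis `ins q ⟨1, trivial⟩ η = 0`)
(`ChevalleyEilenbergCentralBasic.mem_rel_centralSup_succ_iff` and Cartan's formula
`θ_Z = i_Z d + d i_Z`). [cite: BorelWallach2000, I §1.3, §5.1]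

## References

* A. Borel, N. Wallach, *Continuous cohomology, discrete subgroups, and representations of reductive
  groups*, 2nd ed. (2000), I §1.3, §5.1 (held). [BorelWallach2000]
-/

noncomputable section

namespace Literature.NumberTheory.Automorphic

-- Mathlib idiom (as in `GKModules`): commutator bracket on matrix algebras and `Module.End`
attribute [local instance 100] LieRing.ofAssociativeRing

-- `Classical`: the place subtypes indexing `mixedSpace K` are `Fintype` classically (as in `AdelicGLnGlue`).
open scoped TensorProduct Classical _root_.Matrix
open _root_.NumberField _root_.NumberField.mixedEmbedding Literature.Algebra.Lie.ChevalleyEilenberg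

namespace ConeDictionary

variable {n : ℕ} {K : Type} [Field K] [NumberField K] {hcpt : isCompact_glFiniteIntegralLevel n K}
  (π : AutomorphicRepData (AutomorphyDatum.gl n K hcpt))
  (S : Finset {w : InfinitePlace K // w.IsReal}) (lam : (K →+* ℂ) → Fin n → ℤ)

set_option maxHeartbeats 800000 in
-- one-time re-typing of `ResGLnCartan.lie_one` over the datum (definitional)
/-- `Z = 1` is central in the Lie algebra of the datum. [folklore] -/
theorem lie_oneD (X : 𝔤D n K hcpt) : ⁅(⟨1, trivial⟩ : (AutomorphyDatum.gl n K hcpt).arch.lie), X⁆ = 0 :=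
  ResGLnCartan.lie_one (n := n) (K := K) X

set_option maxHeartbeats 800000 in
-- as above
/-- `K'` over the datum is `𝔨 + ℝ·1` for the datum's `𝔨 = kInLie` (definitional). [folklore] -/
theorem kPrimeD_eq_centralSup :
    kPrimeD n K hcpt =
      centralSup (AutomorphyDatum.gl n K hcpt).arch.kInLie (⟨1, trivial⟩ : (AutomorphyDatum.gl n K hcpt).arch.lie)
        (lie_oneD (hcpt := hcpt)) :=
  rfl

set_option maxHeartbeats 800000 in
-- as above
/-- A cochain of `gkComplexLS π S λ` of positive degree is relative for the datum's `𝔨`.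
[cite: BorelWallach2000, I §5.1 (1)–(2)] -/
theorem mem_rel_kInLie_of_mem_gkComplexLS (q : ℕ) {η : Cochain π lam (q + 1)}
    (hη : η ∈ (gkComplexLS π S lam).carrier (q + 1)) :
    η ∈ (Subcomplex.rel ℝ (𝔤D n K hcpt) (Carrier π lam) (AutomorphyDatum.gl n K hcpt).arch.kInLie).carrier (q + 1) := by
  rw [Subcomplex.mem_rel_succ_iff]
  exact ((mem_gkComplex_succ_iff _ _ _ _ q η).1 hη).1

set_option maxHeartbeats 800000 in
-- as above
/-- **Basic cocycles are `K'`-relative** (Step 0): if `η ∈ C^{q+1}(𝔤, K_∞; W ⊗ E_λ)` is basic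
(`i_Z η = 0`) and closed then `η` lies in the relative complex for `K' = 𝔨 ⊕ ℝ·1` — the complex on
which Kuga's lemma `d_eq_zero_and_coclosed_of_casimir_scalar` is run.
[cite: BorelWallach2000, I §1.3, §5.1] -/
theorem mem_rel_kPrimeD_of_basic_cocycle (q : ℕ) {η : Cochain π lam (q + 1)}
    (hη : η ∈ (gkComplexLS π S lam).carrier (q + 1))
    (hins : ins q (⟨1, trivial⟩ : (AutomorphyDatum.gl n K hcpt).arch.lie) η = 0)
    (hd : d ℝ (𝔤D n K hcpt) (Carrier π lam) (q + 1) η = 0) :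
    η ∈ (Subcomplex.rel ℝ (𝔤D n K hcpt) (Carrier π lam) (kPrimeD n K hcpt)).carrier (q + 1) := by
  rw [kPrimeD_eq_centralSup, mem_rel_centralSup_succ_iff]
  exact ⟨mem_rel_kInLie_of_mem_gkComplexLS π S lam q hη, hins, lieDer_eq_zero_of_ins_eq_zero_of_d_eq_zero q _ η hins hd⟩

end ConeDictionary

end Literature.NumberTheory.Automorphic

end
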